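import Mathlib
import Summits.ValiantsHypothesis.ValiantsHypothesis.Theses.TwistedDetRank

/-!
# Route TwistedDetRank — assembly item `Assembly` (stmt-ValiantsHypothesis-6292)

`TdrPerNotQP → FermionicNormalForm → ValiantsHypothesis`.  Pure bookkeeping plus one proved
cone fact: were `VP ℂ = VNP ℂ`, the permanent family would be p-computable
(`Literature.Computability.AlgebraicComplexity.isPComputable_perPoly_complex_iff`, proved in
`ValiantConjectureEquivProofs.lean`); `per_n` is the class-function generalised matrix function
with `χ ≡ 1`, so `FermionicNormalForm` yields a quasi-polynomial bound on the number of twisted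
determinants representing `per_n` for every `n ≥ 1` (and `n = 0` is served by one empty
determinant), contradicting `TdrPerNotQP`.
-/

-- `Summit.ValiantsHypothesis.ValiantsHypothesis.…` is the tree's mandated single-conjunct layout
-- (Sub = Summit), so the duplicated namespace component is intended.
set_option linter.dupNamespace false

namespace Summit.ValiantsHypothesis.ValiantsHypothesis.Theorems.TwistedDetRank

/-- The permanent polynomial `per_n` is the generalised matrix function with constant
coefficient `χ ≡ 1`: `∑_σ C 1 * ∏_i X_{σ i, i} = perPoly (Fin n) ℂ`. -/
theorem assembly_sum_one_mul_prod_eq_perPoly (n : ℕ) :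
    (∑ σ : Equiv.Perm (Fin n), MvPolynomial.C (1 : ℂ) *
        ∏ i : Fin n, (MvPolynomial.X (σ i, i) : MvPolynomial (Fin n × Fin n) ℂ)) =
      Literature.Computability.AlgebraicComplexity.perPoly (Fin n) ℂ := by
  simp [Literature.Computability.AlgebraicComplexity.perPoly, Matrix.permanent]

/-- **Item `stmt-ValiantsHypothesis-6292`** (`Assembly`, route TwistedDetRank):
`TdrPerNotQP → FermionicNormalForm → ValiantsHypothesis`.  Assume `VP ℂ = VNP ℂ`; then the
permanent family is p-computable, hence (as the `χ ≡ 1` class-function family) has a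
quasi-polynomially bounded twisted-determinantal representation by `FermionicNormalForm`,
contradicting `TdrPerNotQP`. [folklore; Burgisser2000, Valiant1979] -/
theorem assembly_proof :
    Summit.ValiantsHypothesis.ValiantsHypothesis.Theses.TwistedDetRank.Assembly := by
  unfold Theses.TwistedDetRank.Assembly Theses.TwistedDetRank.TdrPerNotQP
    Theses.TwistedDetRank.FermionicNormalForm
  intro hX1 hX2
  show Literature.Computability.AlgebraicComplexity.VP ℂ ≠
    Literature.Computability.AlgebraicComplexity.VNP ℂ
  intro hEq
  have hper : Literature.Computability.AlgebraicComplexity.IsPComputable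
      (fun n => Literature.Computability.AlgebraicComplexity.perPoly (Fin n) ℂ) :=
    Literature.Computability.AlgebraicComplexity.isPComputable_perPoly_complex_iff.2 hEq
  have hfun : (fun n => ∑ σ : Equiv.Perm (Fin n), MvPolynomial.C (1 : ℂ) *
        ∏ i : Fin n, (MvPolynomial.X (σ i, i) : MvPolynomial (Fin n × Fin n) ℂ)) =
      (fun n => Literature.Computability.AlgebraicComplexity.perPoly (Fin n) ℂ) :=
    funext assembly_sum_one_mul_prod_eq_perPoly
  have hcomp : Literature.Computability.AlgebraicComplexity.IsPComputable
      (fun n => ∑ σ : Equiv.Perm (Fin n), MvPolynomial.C (1 : ℂ) *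
        ∏ i : Fin n, (MvPolynomial.X (σ i, i) : MvPolynomial (Fin n × Fin n) ℂ)) := by
    rw [hfun]; exact hper
  obtain ⟨c, hc⟩ := hX2 (fun _ _ => (1 : ℂ)) (fun _ _ _ => rfl) hcomp
  apply hX1
  refine ⟨c, fun n => ?_⟩
  rcases Nat.eq_zero_or_pos n with rfl | hn
  · refine ⟨1, Nat.one_le_two_pow, fun _ => 0, ?_⟩
    simp [Literature.Computability.AlgebraicComplexity.perPoly, Matrix.permanent_isEmpty,
      Matrix.det_isEmpty]
  · obtain ⟨r, hr, E, hE⟩ := hc n hn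
    exact ⟨r, hr, E, (assembly_sum_one_mul_prod_eq_perPoly n).symm.trans hE⟩

end Summit.ValiantsHypothesis.ValiantsHypothesis.Theorems.TwistedDetRank
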